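import Summits.QuantumFields.YangMills.Theorems.BalabanUVNodesN12LeafIntAtRecord13
import Summits.QuantumFields.YangMills.Theorems.BalabanUVNodesN12AtRecord12LiveSelector
import Literature.MathematicalPhysics.QuantumFieldTheory.Balaban1983to89.Node00.Record13LiveSelector
import Literature.MathematicalPhysics.QuantumFieldTheory.Balaban1983to89.Node00.Record12LiveSelectorInt
import Literature.MathematicalPhysics.QuantumFieldTheory.Balaban1983to89.Node00.N24NodesStage13FourPinPointed
import Literature.MathematicalPhysics.QuantumFieldTheory.Balaban1983to89.B16RLeafRecord13Live

/-!
# BalabanUVNodes ∕ N12 ON THE STAGE-13 LIVE LINE — at K0a's live re-pin `Θ.liveRepin₁₃` the fibre-witness display of the [IV] leaf at `WOfRecord₁₃` is FREE, the denominator-mass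
# display READS «every LIVE pre-𝐑 term has positive mass» (Int currency, from `Provisos₁₃` at the re-pin), and the N12 row of n24-c's four-pin Stage-13 sockets is fed run by run
# (sequel of `BalabanUVNodesN12LeafIntAtRecord13`; Track A, DAG node N12 = [B15, Balaban1989LargeFieldI] CMP **122** (1989) 175–202; cluster K1‴ `StabilityBAtRecordR13e` =
# stmt-QuantumFields-19910 (rev 16; `stub_nodes13`'s row `h12`); seat `pub-ymgap-dag-n12-d` g6 (R134 s2), 2026-08-27; count-neutral, NOT a discharge)

HONEST FRAMING.  Count-neutral kernel BOOKKEEPING BY NAME over module A (the integrable-currency leaf), K0a's `Node00/Record13LiveSelector` (`liveRepin₁₃`, `slotsNondegenerate₁₃_liveRepin`,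
`ZtUnity.liveRepin₁₃`) and `Node00/Record12LiveSelectorInt` (history-generic Int liveness `exists_liveSeq_ppSelLive_of_int`), K0b's `exists_ne_zero_and_fibreIntegral_ne_zero_of_integrable`,
dag-n11-e's `B16RLeafRecord13Live` (`ppSel_succ_idem_of_liveSel`, `laws₁₃_of_liveSel`), dag-n12-e's `fibreWitness_of_idem`, this seat's g4 `forall_mass_pos_ppSelLive_iff`, and dag-n24-c's
module 40 `Node00/N24NodesStage13FourPinPointed` (`N24_nodes₁₃B10YZW_pointed`, `N24_nodesAtSomeRecord₁₃_of_fourPin_pointed`, `N24_stabilityBR13e_thetaShape16_fourPin_pointed`).  Nothing of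
Bałaban's is asserted; `Provisos₁₃` at the re-pin (K0‴), the live-mass display (NODE 00), the (1.100) pin equation (dag-n12-e g5's `pinRPrime₁₃`, `rfl` there), Prop. 1, (1.80), (1.89),
every other node's row and the β-box pair are DISPLAYED; N12 NOT discharged.

* §3 AT THE LIVE RE-PIN `Θ.liveRepin₁₃` (the ₁₃ twin of this seat's g4 `…N12AtRecord12LiveSelector` §2–§3, Int currency): `ppSel_liveRepin₁₃_succ_idem` (shape `Z″″ = Z″`);
  `fibreWitness_liveRepin₁₃_of_massSel` — `hfib` FREE; `liveSeq_of_mass_pos_int` (history-generic: below the torus a pre-𝐑 term with positive mass is LIVE, from def-R's Int provisos);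
  `massSel_liveRepin₁₃_iff` (below the torus, `Provisos₁₃` at the re-pin: `hmassSel` ⟺ «every live pre-𝐑 term has positive mass»); the [IV] leaf at `WOfRecord₁₃ (Θ.liveRepin₁₃) λ P` on
  `hmassSel` without `hfib` (`…_of_massSel`, `…_of_provisosInt_massSel`) and on the live-mass display (`…_of_massLive`).
* §4 SOCKETS (N12-specialised corollaries of n24-c's module 40 AT THE LIVE RE-PIN, with K0‴'s guard `ZtUnity ∧ SlotsNondegenerate₁₃` and N13's (R₁₃) row `hR` DISCHARGED BY NAME there):
  `nodes₁₃B10YZW_pointed_liveRepin₁₃_of_leaf` ∕ `nodesAtSomeRecord₁₃_of_fourPin_liveRepin₁₃_of_leaf` (N12's row handed run by run as `B15Leaf (WOfRecord₁₃ (Θ.liveRepin₁₃) λ P)`) and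
  ★ `nodesAtSomeRecord₁₃_of_fourPin_liveRepin₁₃_of_massLive` ∕ `stabilityBR13e_thetaShape16_fourPin_liveRepin₁₃_of_massLive` (N12's row REPLACED by its per-run displays: below the torus the
  pin equation + live-mass + Prop 1 + (1.80) + (1.89); on runs with `K ≤ kSel P` the leaf handed) — the `stub_nodes13` body ∕ K1‴'s θ-keyed consequent with «which child blocks» read off
  the hypothesis list, N12 resolved into its printed displays.
WHAT N12 THEN COSTS on the Stage-13 live line (typing strength, NOT a second gap): `Provisos₁₃ (Θ.liveRepin₁₃)` (K0‴: K0a's `provisos₁₃_liveRepin₁₃_of_bg ∕ _of_localBg` rows), positive mass of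
the LIVE pre-𝐑 terms below the torus (NODE 00's measure-theoretic residue of p.176 ll.14–16), the (1.100) pin equation (dag-n12-e g5, `rfl` at `λ.pinRPrime₁₃`), Prop. 1 at `λ.LF P`
(dag-n12-c), (1.80) + (1.89) at `λ.D189 P` (dag-n12-e's ₁₃ letters), and the leaf on runs with `K ≤ kSel P`.  One finite four-torus programme at fixed `ε`; nothing continuum ∕ ℝ⁴ ∕
OS ∕ mass gap ∕ Clay.  0 `sorry`, 0 `def`, standard axioms.  Filed `--supports` K1‴ (stmt-QuantumFields-19910) `--as helper`.
Sources: [Balaban1989LargeFieldI] (0.2)–(0.6) pp.176–177, Prop. 1 p.194, (1.80) p.195, (1.89) p.198, (1.99)–(1.102) pp.200–201; [Balaban1988Convergent] (2.18) p.257,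
(3.22)–(3.25) pp.269–270; [Balaban1989LargeFieldII] Thm 1 + (0.1) pp.355–356.
-/

noncomputable section

open MeasureTheory
open scoped Matrix.Norms.L2Operator

namespace Summit.QuantumFields.YangMills.BalabanUVNodes.N12AtRecord13LiveLine

open Literature.MathematicalPhysics.QuantumFieldTheory.Balaban1983to89
open Literature.MathematicalPhysics.QuantumFieldTheory.Balaban1983to89.T4Continuum (T4Family)
open Literature.MathematicalPhysics.QuantumFieldTheory.Balaban1983to89.DagBinding
  (WorldP leavesP PrintedCarriersR PrintedCarriers15 B15Leaf B8LeafR B9LeafX B11Leaf Nodes)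
open Literature.MathematicalPhysics.QuantumFieldTheory.Balaban1983to89.Node00
open FlowStep (BetaLowerH BetaUpperH)
open FlowStepRuns (genFlow)
open B15Claim189Assembly (new189 chiPP dom)
open B15 (Prop1Printed Ineq180)
open B15.BasicStep (Claim189 fibreIntegral)
open B8Eq17ClassAkV1 (plaqsOf)
open B15LeafKnitMassSel (fibreWitness_of_idem)
open B15RPrime1100OfRep (rPrimeDataOfSel)
open B16RLeafRecord13Live (ppSel_succ_idem_of_liveSel laws₁₃_of_liveSel)
open Summit.QuantumFields.YangMills.BalabanUVNodes.N12AtRecord12LiveSelector (forall_mass_pos_ppSelLive_iff)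
open Summit.QuantumFields.YangMills.BalabanUVNodes.N12LeafIntAtRecord13
  (b15Leaf_WOfRecord₁₃_of_massSel b15Leaf_WOfRecord₁₃_of_provisosInt_massSel)

variable {N : ℕ} [NeZero N] {F : T4Family}

/-! ## §3a HISTORY-GENERIC, INT CURRENCY — below the torus a pre-𝐑 term with positive mass is LIVE -/

section IntGeneric
variable (ν : Stage7Numerics) (τ : TowerNumerics) (E : B12.RunParams → ℝ) (w : StepWeightsOfRecord F N ν τ.M) (ppSel : PpSelOfRecord F ν τ.M)
  (p : B12.RunParams) (g : ℕ → ℝ) (k : ℕ)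

/-- **A PRE-𝐑 TERM WITH POSITIVE MASS IS LIVE, Int currency, any history ∕ selector**: with the Int provisos of the knit datum at level `k+1` (integrable, a.e. `≥ 0`), `0 < ∫dV t_s` puts a
configuration where `(𝐓e^A)(s)` and `∫⌈_{Z′(s)} t_s` are both non-zero (K0b's `exists_ne_zero_and_fibreIntegral_ne_zero_of_integrable`), hence `LiveSeq` (K0a's `liveSeq_of_ne_zero`).  The ₁₃ ∕ Int
twin of this seat's g4 `liveSeq_of_mass_pos`. [cite: Balaban1989LargeFieldI, (0.2)–(0.3) p.176, p.176 ll.14–16; Balaban1988Convergent, (2.18) p.257, (3.25) p.270] -/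
theorem liveSeq_of_mass_pos_int
    (hR : (towerRepOfRecord F N ν τ (slotsTOfRecord F N ν τ E w ppSel) ppSel p g (k + 1)).toRepData.ProvisosInt)
    (s : SeqOfRecord F ν τ.M g p.K (k + 1))
    (hmass : 0 < ∫ V, rterm (repTOfRecord9 F N ν τ E w ppSel p g k) s V ∂(fieldMeasure (F.P p.K) (k + 1) (SU N))) :
    LiveSeq F N ν τ p g (k + 1) (slotsTOfRecord F N ν τ E w ppSel p g (k + 1)) s := by
  obtain ⟨hint, h0, -⟩ := hR
  obtain ⟨V, htV, hFV⟩ := exists_ne_zero_and_fibreIntegral_ne_zero_of_integrable (hD := inferInstance)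
    (fibOfSeq F ν τ p g (k + 1) s) (hint s) (h0 s) hmass.ne'
  exact liveSeq_of_ne_zero F N _ (mul_ne_zero_iff.1 htV).2 hFV

end IntGeneric

/-! ## §3 AT THE LIVE RE-PIN `Θ.liveRepin₁₃` — `hfib` FREE; below the torus `hmassSel` ⟺ positive mass of the LIVE terms; N12's leaf at `WOfRecord₁₃` -/

section Repin
variable (Θ : Stage13Params F N)

/-- The ₁₃ live re-pin's selector at a positive level is idempotent (shape `Z″″ = Z″`; dag-n11-e's `ppSel_succ_idem_of_liveSel` at K0a's clause `liveRepin₁₃_ppSel`, `rfl`).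
[cite: Balaban1989LargeFieldI, (0.3) p.176 (bookkeeping)] -/
theorem ppSel_liveRepin₁₃_succ_idem (P : B12.RunParams) (k : ℕ)
    (s : SeqOfRecord F Θ.ν Θ.τ9.M (gOfRecord₁₃ F N (Θ.liveRepin₁₃ F N) P) P.K (k + 1)) :
    (Θ.liveRepin₁₃ F N).ppSel P (gOfRecord₁₃ F N (Θ.liveRepin₁₃ F N) P) (k + 1)
        ((Θ.liveRepin₁₃ F N).ppSel P (gOfRecord₁₃ F N (Θ.liveRepin₁₃ F N) P) (k + 1) s)
      = (Θ.liveRepin₁₃ F N).ppSel P (gOfRecord₁₃ F N (Θ.liveRepin₁₃ F N) P) (k + 1) s :=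
  ppSel_succ_idem_of_liveSel F N (Θ.liveRepin₁₃ F N) (Stage13Params.liveRepin₁₃_ppSel F N Θ) P k s

variable (lam : ResidW F N)

/-- **AT THE ₁₃ LIVE RE-PIN N12's FIBRE-WITNESS DISPLAY IS FREE**: `hfib` follows from `hmassSel` (dag-n12-e's `fibreWitness_of_idem` at the idempotent live selector), every run, every step.
[cite: Balaban1989LargeFieldI, (0.3) p.176, p.176 ll.14–16 (bookkeeping)] -/
theorem fibreWitness_liveRepin₁₃_of_massSel (P : B12.RunParams)
    (hmassSel : ∀ s, 0 < ∫ V, rterm (reprTOfRecord₁₃ F N (Θ.liveRepin₁₃ F N) P (lam.kSel P))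
        ((Θ.liveRepin₁₃ F N).ppSel P (gOfRecord₁₃ F N (Θ.liveRepin₁₃ F N) P) (lam.kSel P + 1) s) V
          ∂(fieldMeasure (F.P P.K) (lam.kSel P + 1) (SU N))) :
    ∀ s, ∃ s', (Θ.liveRepin₁₃ F N).ppSel P (gOfRecord₁₃ F N (Θ.liveRepin₁₃ F N) P) (lam.kSel P + 1) s'
        = (Θ.liveRepin₁₃ F N).ppSel P (gOfRecord₁₃ F N (Θ.liveRepin₁₃ F N) P) (lam.kSel P + 1) s ∧
      0 < ∫ V, rterm (reprTOfRecord₁₃ F N (Θ.liveRepin₁₃ F N) P (lam.kSel P)) s' V ∂(fieldMeasure (F.P P.K) (lam.kSel P + 1) (SU N)) :=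
  fibreWitness_of_idem _ _ (ppSel_liveRepin₁₃_succ_idem Θ P (lam.kSel P)) hmassSel

/-- **BELOW THE TORUS, AT THE ₁₃ LIVE RE-PIN WITH ITS STAGE-13 PROVISOS, N12's MASS DISPLAY ⟺ «every LIVE pre-𝐑 term has positive mass»** (Int currency): a live sequence exists at
level `k+1 ≤ K` by K0a's `exists_liveSeq_ppSelLive_of_int` fed by `Provisos₁₃.tstep ∕ .rstep` AT THE RE-PIN (displayed — they read the selector; K0‴'s content there), so the live selector's
range IS the live set (this seat's g4 `forall_mass_pos_ppSelLive_iff`). [cite: Balaban1989LargeFieldI, (0.3) p.176, p.176 ll.14–16; Balaban1988Convergent, (3.22)–(3.25) pp.269–270] -/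
theorem massSel_liveRepin₁₃_iff (hP : (Θ.liveRepin₁₃ F N).Provisos₁₃ F N) (P : B12.RunParams) {k : ℕ} (hk : k < P.K) :
    (∀ s, 0 < ∫ V, rterm (reprTOfRecord₁₃ F N (Θ.liveRepin₁₃ F N) P k)
        ((Θ.liveRepin₁₃ F N).ppSel P (gOfRecord₁₃ F N (Θ.liveRepin₁₃ F N) P) (k + 1) s) V ∂(fieldMeasure (F.P P.K) (k + 1) (SU N))) ↔
      ∀ s, LiveSeq F N Θ.ν Θ.τ9 P (gOfRecord₁₃ F N (Θ.liveRepin₁₃ F N) P) (k + 1)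
          (slotsTOfRecord F N Θ.ν Θ.τ9 (EOfRecord₁₃ F N (Θ.liveRepin₁₃ F N)) (wOfRecord₉ F N (Θ.liveRepin₁₃ F N).toStage9Params)
            (Θ.liveRepin₁₃ F N).ppSel P (gOfRecord₁₃ F N (Θ.liveRepin₁₃ F N) P) (k + 1)) s →
        0 < ∫ V, rterm (reprTOfRecord₁₃ F N (Θ.liveRepin₁₃ F N) P k) s V ∂(fieldMeasure (F.P P.K) (k + 1) (SU N)) := by
  have hex := exists_liveSeq_ppSelLive_of_int F N Θ.ν Θ.τ9 (EOfRecord₁₃ F N Θ) (wOfRecord₉ F N Θ.toStage9Params) P (gOfRecord₁₃ F N Θ P)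
    (fun j hj => hP.tstep P j hj) (fun j _ hj => hP.rstep P j hj) k hk
  exact forall_mass_pos_ppSelLive_iff (EOfRecord₁₃ F N Θ) (wOfRecord₉ F N Θ.toStage9Params) P (gOfRecord₁₃ F N Θ P) k hex _ _

/-- **THE [IV] LEAF AT THE ₁₃ LIVE RE-PIN's BUNDLE OF RECORD, `kSel P < K` — `hfib` DROPPED** (module A's `b15Leaf_WOfRecord₁₃_of_massSel` at `Θ.liveRepin₁₃`, the fibre witness by
`fibreWitness_liveRepin₁₃_of_massSel`).  Displayed: `Provisos₁₃` at the re-pin, the (1.100) pin equation, the denominator masses, Prop. 1 (1.78), (1.80), (1.89).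
[cite: Balaban1989LargeFieldI, (0.2)–(0.6) p.176, p.176 ll.14–16, Prop. 1 (1.78) p.194, (1.80) p.195, (1.89) p.198, (1.99)–(1.102) pp.200–201] -/
theorem b15Leaf_WOfRecord₁₃_liveRepin₁₃_of_massSel (hP : (Θ.liveRepin₁₃ F N).Provisos₁₃ F N) {P : B12.RunParams} (hk : lam.kSel P < P.K)
    (hpin : lam.D1100 P
      = rPrimeDataOfSel (reprTOfRecord₁₃ F N (Θ.liveRepin₁₃ F N) P (lam.kSel P))
          ((Θ.liveRepin₁₃ F N).ppSel P (gOfRecord₁₃ F N (Θ.liveRepin₁₃ F N) P) (lam.kSel P + 1))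
          (fibOfSeq F (Θ.liveRepin₁₃ F N).ν (Θ.liveRepin₁₃ F N).τ9 P (gOfRecord₁₃ F N (Θ.liveRepin₁₃ F N) P) (lam.kSel P + 1)))
    (hmassSel : ∀ s, 0 < ∫ V, rterm (reprTOfRecord₁₃ F N (Θ.liveRepin₁₃ F N) P (lam.kSel P))
        ((Θ.liveRepin₁₃ F N).ppSel P (gOfRecord₁₃ F N (Θ.liveRepin₁₃ F N) P) (lam.kSel P + 1) s) V ∂(fieldMeasure (F.P P.K) (lam.kSel P + 1) (SU N)))
    (hP1 : Prop1Printed (lam.LF P))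
    (h180 : ∀ U, new189 (lam.D189 P) U → ∀ i, (lam.D189 P).h ≤ i → i ≤ (lam.D189 P).k → ∀ q ∈ plaqsOf (dom (lam.D189 P) i),
      Ineq180 ((lam.D189 P).dev0 U q) ((lam.D189 P).ε (lam.D189 P).k) (lam.D189 P).η (lam.D189 P).B₃ (lam.D189 P).B₅ (lam.D189 P).M (lam.D189 P).δ
        ((lam.D189 P).dist q) (lam.D189 P).O1)
    (h189 : Claim189 (new189 (lam.D189 P)) (chiPP (lam.D189 P))) : B15Leaf (WOfRecord₁₃ F N (Θ.liveRepin₁₃ F N) lam P) :=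
  b15Leaf_WOfRecord₁₃_of_massSel (Θ.liveRepin₁₃ F N) lam hP hk hpin hmassSel (fibreWitness_liveRepin₁₃_of_massSel Θ lam P hmassSel) hP1 h180 h189

/-- **… ANY RUN, from the Int provisos of the knit datum at the re-pin DISPLAYED** (the degenerate-run form; `hfib` dropped). [cite: Balaban1989LargeFieldI, (0.2)–(0.6) p.176, Prop. 1 (1.78) p.194, (1.80) p.195, (1.89) p.198, (1.99)–(1.102) pp.200–201] -/
theorem b15Leaf_WOfRecord₁₃_liveRepin₁₃_of_provisosInt_massSel {P : B12.RunParams}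
    (hint : (repDataOfSel (reprTOfRecord₁₃ F N (Θ.liveRepin₁₃ F N) P (lam.kSel P))
      ((Θ.liveRepin₁₃ F N).ppSel P (gOfRecord₁₃ F N (Θ.liveRepin₁₃ F N) P) (lam.kSel P + 1))
      (fibOfSeq F (Θ.liveRepin₁₃ F N).ν (Θ.liveRepin₁₃ F N).τ9 P (gOfRecord₁₃ F N (Θ.liveRepin₁₃ F N) P) (lam.kSel P + 1))).ProvisosInt)
    (hpin : lam.D1100 P
      = rPrimeDataOfSel (reprTOfRecord₁₃ F N (Θ.liveRepin₁₃ F N) P (lam.kSel P))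
          ((Θ.liveRepin₁₃ F N).ppSel P (gOfRecord₁₃ F N (Θ.liveRepin₁₃ F N) P) (lam.kSel P + 1))
          (fibOfSeq F (Θ.liveRepin₁₃ F N).ν (Θ.liveRepin₁₃ F N).τ9 P (gOfRecord₁₃ F N (Θ.liveRepin₁₃ F N) P) (lam.kSel P + 1)))
    (hmassSel : ∀ s, 0 < ∫ V, rterm (reprTOfRecord₁₃ F N (Θ.liveRepin₁₃ F N) P (lam.kSel P))
        ((Θ.liveRepin₁₃ F N).ppSel P (gOfRecord₁₃ F N (Θ.liveRepin₁₃ F N) P) (lam.kSel P + 1) s) V ∂(fieldMeasure (F.P P.K) (lam.kSel P + 1) (SU N)))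
    (hP1 : Prop1Printed (lam.LF P))
    (h180 : ∀ U, new189 (lam.D189 P) U → ∀ i, (lam.D189 P).h ≤ i → i ≤ (lam.D189 P).k → ∀ q ∈ plaqsOf (dom (lam.D189 P) i),
      Ineq180 ((lam.D189 P).dev0 U q) ((lam.D189 P).ε (lam.D189 P).k) (lam.D189 P).η (lam.D189 P).B₃ (lam.D189 P).B₅ (lam.D189 P).M (lam.D189 P).δ
        ((lam.D189 P).dist q) (lam.D189 P).O1)
    (h189 : Claim189 (new189 (lam.D189 P)) (chiPP (lam.D189 P))) : B15Leaf (WOfRecord₁₃ F N (Θ.liveRepin₁₃ F N) lam P) :=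
  b15Leaf_WOfRecord₁₃_of_provisosInt_massSel (Θ.liveRepin₁₃ F N) lam hint hpin hmassSel (fibreWitness_liveRepin₁₃_of_massSel Θ lam P hmassSel)
    hP1 h180 h189

/-- **★ THE [IV] LEAF AT THE ₁₃ LIVE RE-PIN's BUNDLE OF RECORD ON THE LIVE-MASS PROVISO** (`kSel P < K`): `Provisos₁₃` at the re-pin + the (1.100) pin equation + «every LIVE pre-𝐑 term at level
`kSel P + 1` has positive mass» + EXACTLY Proposition 1 (1.78), (1.80), (1.89) — NO `hfib`, NO selector-keyed mass display. [cite: Balaban1989LargeFieldI, (0.2)–(0.6) p.176, p.176 ll.14–16, Prop. 1 (1.78) p.194, (1.80) p.195, (1.89) p.198, (1.99)–(1.102) pp.200–201; Balaban1988Convergent, (3.22)–(3.25) pp.269–270] -/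
theorem b15Leaf_WOfRecord₁₃_liveRepin₁₃_of_massLive (hP : (Θ.liveRepin₁₃ F N).Provisos₁₃ F N) {P : B12.RunParams} (hk : lam.kSel P < P.K)
    (hpin : lam.D1100 P
      = rPrimeDataOfSel (reprTOfRecord₁₃ F N (Θ.liveRepin₁₃ F N) P (lam.kSel P))
          ((Θ.liveRepin₁₃ F N).ppSel P (gOfRecord₁₃ F N (Θ.liveRepin₁₃ F N) P) (lam.kSel P + 1))
          (fibOfSeq F (Θ.liveRepin₁₃ F N).ν (Θ.liveRepin₁₃ F N).τ9 P (gOfRecord₁₃ F N (Θ.liveRepin₁₃ F N) P) (lam.kSel P + 1)))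
    (hmassLive : ∀ s, LiveSeq F N Θ.ν Θ.τ9 P (gOfRecord₁₃ F N (Θ.liveRepin₁₃ F N) P) (lam.kSel P + 1)
        (slotsTOfRecord F N Θ.ν Θ.τ9 (EOfRecord₁₃ F N (Θ.liveRepin₁₃ F N)) (wOfRecord₉ F N (Θ.liveRepin₁₃ F N).toStage9Params)
          (Θ.liveRepin₁₃ F N).ppSel P (gOfRecord₁₃ F N (Θ.liveRepin₁₃ F N) P) (lam.kSel P + 1)) s →
      0 < ∫ V, rterm (reprTOfRecord₁₃ F N (Θ.liveRepin₁₃ F N) P (lam.kSel P)) s V ∂(fieldMeasure (F.P P.K) (lam.kSel P + 1) (SU N)))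
    (hP1 : Prop1Printed (lam.LF P))
    (h180 : ∀ U, new189 (lam.D189 P) U → ∀ i, (lam.D189 P).h ≤ i → i ≤ (lam.D189 P).k → ∀ q ∈ plaqsOf (dom (lam.D189 P) i),
      Ineq180 ((lam.D189 P).dev0 U q) ((lam.D189 P).ε (lam.D189 P).k) (lam.D189 P).η (lam.D189 P).B₃ (lam.D189 P).B₅ (lam.D189 P).M (lam.D189 P).δ
        ((lam.D189 P).dist q) (lam.D189 P).O1)
    (h189 : Claim189 (new189 (lam.D189 P)) (chiPP (lam.D189 P))) : B15Leaf (WOfRecord₁₃ F N (Θ.liveRepin₁₃ F N) lam P) :=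
  b15Leaf_WOfRecord₁₃_liveRepin₁₃_of_massSel Θ lam hP hk hpin ((massSel_liveRepin₁₃_iff Θ hP P hk).2 hmassLive) hP1 h180 h189

/-- **N12's ROW FOR A WHOLE TOWER OF RUNS, run by run**: below the torus (`kSel P < K`) the live-mass form, on the other runs (`K ≤ kSel P`, where the record displays no tower clause) the
leaf handed as is. [cite: Balaban1989LargeFieldI, (0.2)–(0.6) p.176, Prop. 1 (1.78) p.194, (1.80) p.195, (1.89) p.198, (1.99)–(1.102) pp.200–201 (bookkeeping)] -/
theorem b15Leaf_WOfRecord₁₃_liveRepin₁₃_all_of_massLive (hP : (Θ.liveRepin₁₃ F N).Provisos₁₃ F N)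
    (hdeg : ∀ P : B12.RunParams, P.K ≤ lam.kSel P → B15Leaf (WOfRecord₁₃ F N (Θ.liveRepin₁₃ F N) lam P))
    (hpin : ∀ P : B12.RunParams, lam.kSel P < P.K → lam.D1100 P
      = rPrimeDataOfSel (reprTOfRecord₁₃ F N (Θ.liveRepin₁₃ F N) P (lam.kSel P))
          ((Θ.liveRepin₁₃ F N).ppSel P (gOfRecord₁₃ F N (Θ.liveRepin₁₃ F N) P) (lam.kSel P + 1))
          (fibOfSeq F (Θ.liveRepin₁₃ F N).ν (Θ.liveRepin₁₃ F N).τ9 P (gOfRecord₁₃ F N (Θ.liveRepin₁₃ F N) P) (lam.kSel P + 1)))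
    (hmassLive : ∀ P : B12.RunParams, lam.kSel P < P.K → ∀ s, LiveSeq F N Θ.ν Θ.τ9 P (gOfRecord₁₃ F N (Θ.liveRepin₁₃ F N) P) (lam.kSel P + 1)
        (slotsTOfRecord F N Θ.ν Θ.τ9 (EOfRecord₁₃ F N (Θ.liveRepin₁₃ F N)) (wOfRecord₉ F N (Θ.liveRepin₁₃ F N).toStage9Params)
          (Θ.liveRepin₁₃ F N).ppSel P (gOfRecord₁₃ F N (Θ.liveRepin₁₃ F N) P) (lam.kSel P + 1)) s →
      0 < ∫ V, rterm (reprTOfRecord₁₃ F N (Θ.liveRepin₁₃ F N) P (lam.kSel P)) s V ∂(fieldMeasure (F.P P.K) (lam.kSel P + 1) (SU N)))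
    (hP1 : ∀ P : B12.RunParams, lam.kSel P < P.K → Prop1Printed (lam.LF P))
    (h180 : ∀ P : B12.RunParams, lam.kSel P < P.K → ∀ U, new189 (lam.D189 P) U → ∀ i, (lam.D189 P).h ≤ i → i ≤ (lam.D189 P).k →
      ∀ q ∈ plaqsOf (dom (lam.D189 P) i),
        Ineq180 ((lam.D189 P).dev0 U q) ((lam.D189 P).ε (lam.D189 P).k) (lam.D189 P).η (lam.D189 P).B₃ (lam.D189 P).B₅ (lam.D189 P).M (lam.D189 P).δ
          ((lam.D189 P).dist q) (lam.D189 P).O1)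
    (h189 : ∀ P : B12.RunParams, lam.kSel P < P.K → Claim189 (new189 (lam.D189 P)) (chiPP (lam.D189 P))) :
    ∀ P : B12.RunParams, B15Leaf (WOfRecord₁₃ F N (Θ.liveRepin₁₃ F N) lam P) := fun P => by
  by_cases hk : lam.kSel P < P.K
  · exact b15Leaf_WOfRecord₁₃_liveRepin₁₃_of_massLive Θ lam hP hk (hpin P hk) (hmassLive P hk) (hP1 P hk) (h180 P hk) (h189 P hk)
  · exact hdeg P (not_lt.1 hk)

end Repin

/-! ## §4 SOCKETS — dag-n24-c's four-pin Stage-13 sockets AT THE LIVE RE-PIN with W READ AT THE BUNDLE OF RECORD, N12's row from §3 -/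

section Sockets
variable (Θ : Stage13Params F N) (lamW : ResidW F N)

/-- **THE THIRTEEN NODES AT A WORLD BOUND TO THE FOUR-PIN STAGE-13 VIEW OF THE LIVE RE-PIN, N12's ROW HANDED RUN BY RUN** — n24-c's `N24_nodes₁₃B10YZW_pointed` at `θ := Θ.liveRepin₁₃` with
N13's (R₁₃) row DISCHARGED by dag-n11-e's `laws₁₃_of_liveSel` (clause `liveRepin₁₃_ppSel`, `rfl`); the other rows displayed as there.  COMPOSITE: nothing is discharged as a node.
[cite: Balaban1989LargeFieldII, Thm 1 p.355, (0.1) pp.355–356; Balaban1989LargeFieldI, (0.2)–(0.4) p.176, Prop. 1 p.194; Balaban1988Convergent, Thm 2 p.263, (3.22) p.269 (bookkeeping)] -/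
theorem nodes₁₃B10YZW_pointed_liveRepin₁₃_of_leaf (hP : (Θ.liveRepin₁₃ F N).Provisos₁₃ F N) (hθ : Θ.Admissible F N)
    (hκ : 0 ≤ Θ.s2.lf.κ) (hE₀ : 0 ≤ Θ.s2.lf.E₀) (hB₀ : 0 ≤ Θ.s2.lf.B₀)
    (Mstar : ℕ) (ops : OpsY N (Θ.liveRepin₁₃ F N).toStage3Params Mstar) (ζ : ResidZ F N) (w : WorldP)
    (hC : w.C = (datumOfRecord₁₃ F N (Θ.liveRepin₁₃ F N) hP).C) (hγ : 0 < w.γ ∧ w.γ ≤ (Θ.liveRepin₁₃ F N).γ) (hL : w.L = ((Θ.liveRepin₁₃ F N).L : ℝ))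
    (hup : ∀ P, w.up P = upOfRecord₅C F N ((Θ.liveRepin₁₃ F N).view₁₃B10YZW F N Mstar ops ζ lamW) P)
    (h05 : ∀ P : B12.RunParams,
      B8LeafR ((Θ.liveRepin₁₃ F N).res.X P).d8 ((Θ.liveRepin₁₃ F N).res.X P).L8 ((Θ.liveRepin₁₃ F N).res.X P).C₂ ((Θ.liveRepin₁₃ F N).res.X P).B₁'
        ((Θ.liveRepin₁₃ F N).res.X P).B₀' ((Θ.liveRepin₁₃ F N).res.X P).B₁ ((Θ.liveRepin₁₃ F N).res.X P).B₂ ((Θ.liveRepin₁₃ F N).res.X P).c₁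
        ((Θ.liveRepin₁₃ F N).res.X P).inp8 ((Θ.liveRepin₁₃ F N).res.X P).B₀β ((Θ.liveRepin₁₃ F N).res.X P).loc8 ((Θ.liveRepin₁₃ F N).res.X P).fam8R
        ((Θ.liveRepin₁₃ F N).res.X P).lan8 ((Θ.liveRepin₁₃ F N).res.X P).cub8 ((Θ.liveRepin₁₃ F N).res.X P).toAxial8)
    (h06 : B9LeafX (Y9OfRecord N (Θ.liveRepin₁₃ F N).toStage3Params Mstar ops))
    (h07 : B11Leaf (Z11OfRecord F N ζ))
    (h08 : PrintedUV3V N (Θ.liveRepin₁₃ F N).L)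
    (h09 : ∀ P : B12.RunParams, B12Sec2to5.Lemma4Printed ((Θ.liveRepin₁₃ F N).res.X P).F12 ((Θ.liveRepin₁₃ F N).res.X P).c12)
    (h09T : ∀ P : B12.RunParams, (leavesP w P).smallCouplings → (leavesP w P).smallFieldInductive)
    (h10 : ∀ P : B12.RunParams, B9LeafX (Y9OfRecord N (Θ.liveRepin₁₃ F N).toStage3Params Mstar ops) →
      (B10.Thm1PrintedCompact (((Θ.liveRepin₁₃ F N).view₁₃B10YZW F N Mstar ops ζ lamW).res.X P).runs10 ∧
          B10.Thm2Printed (((Θ.liveRepin₁₃ F N).view₁₃B10YZW F N Mstar ops ζ lamW).res.X P).runs10) →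
        B11Leaf (Z11OfRecord F N ζ) → B12Sec2to5.Lemma4Printed ((Θ.liveRepin₁₃ F N).res.X P).F12 ((Θ.liveRepin₁₃ F N).res.X P).c12 →
          B13.Lemma1Printed ((Θ.liveRepin₁₃ F N).res.X P).S13 ((Θ.liveRepin₁₃ F N).res.X P).c13 ∧
            B13.Lemma2Printed ((Θ.liveRepin₁₃ F N).res.X P).S13 ((Θ.liveRepin₁₃ F N).res.X P).c13 ∧
            B13.Lemma3Printed ((Θ.liveRepin₁₃ F N).res.X P).S13 ((Θ.liveRepin₁₃ F N).res.X P).c13)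
    (h11 : ∀ P : B12.RunParams, (leavesP w P).b7 → (leavesP w P).b8 → (leavesP w P).b9 → (leavesP w P).b10 → (leavesP w P).b11 →
      (leavesP w P).smallCouplings → (leavesP w P).smallFieldInductive → (leavesP w P).flowControl →
        ∀ k, k < P.K → SLaw₁₃ F N (Θ.liveRepin₁₃ F N) P k → TLaw₁₃ F N (Θ.liveRepin₁₃ F N) P k)
    (h12 : ∀ P : B12.RunParams, B15Leaf (WOfRecord₁₃ F N (Θ.liveRepin₁₃ F N) lamW P))
    (hUV : ∀ P : B12.RunParams, (genFlow (betaOfRecord₁₃ F N (Θ.liveRepin₁₃ F N)) P.g0).InInterval w.γ P.K → ∀ k, k ≤ P.K →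
      SLaw₁₃ F N (Θ.liveRepin₁₃ F N) P k → ∀ U : GaugeField (F.P P.K) k (SU N),
        chiβOfRecord₁₃ F N (Θ.liveRepin₁₃ F N) P.K (gOfRecord₁₃ F N (Θ.liveRepin₁₃ F N) P) k U *
              Real.exp (-(1 / (gOfRecord₁₃ F N (Θ.liveRepin₁₃ F N) P k) ^ 2 * wilsonBGOfRecord F N (Θ.liveRepin₁₃ F N).εbg P k U)
                - w.em (gOfRecord₁₃ F N (Θ.liveRepin₁₃ F N) P k) * (Fintype.card (Site (F.P P.K) k) : ℝ)) ≤
            densOfRecord₁₃ F N (Θ.liveRepin₁₃ F N) P k U ∧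
        densOfRecord₁₃ F N (Θ.liveRepin₁₃ F N) P k U ≤ Real.exp (w.ep (gOfRecord₁₃ F N (Θ.liveRepin₁₃ F N) P k) * (Fintype.card (Site (F.P P.K) k) : ℝ))) :
    IsRecordOfRecord₁₃C F N (datumOfRecord₁₃ F N (Θ.liveRepin₁₃ F N) hP) w ∧ ∀ P : B12.RunParams, Nodes (leavesP w P) :=
  N24_nodes₁₃B10YZW_pointed (Θ.liveRepin₁₃ F N) hP hθ.liveRepin₁₃ Mstar ops ζ lamW w hC hγ hL hup h05 h06 h07 h08 h09 h09T h10 h11 h12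
    (fun P k hk => laws₁₃_of_liveSel F N (Θ.liveRepin₁₃ F N) P hP hθ.liveRepin₁₃ hκ hE₀ hB₀ (Stage13Params.liveRepin₁₃_ppSel F N Θ) k hk) hUV

/-- **★ THE BODY OF `NodesAtSomeRecord13` (plan g66 `stub_nodes13`; n24-c module 40's tree `Prop`) OVER THE FOUR-PIN STAGE-13 VIEW OF THE LIVE RE-PIN, N12's ROW REPLACED BY ITS PER-RUN
DISPLAYS** — witnesses `(Θ.liveRepin₁₃, hP, w)`; K0‴'s guard DISCHARGED there (K0a's `ZtUnity.liveRepin₁₃`, `slotsNondegenerate₁₃_liveRepin`), N13's (R₁₃) row by dag-n11-e's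
`laws₁₃_of_liveSel`, N12's `h12` by §3 (`b15Leaf_WOfRecord₁₃_liveRepin₁₃_all_of_massLive`: below the torus the pin equation + live-mass + Prop. 1 + (1.80) + (1.89); on runs with `K ≤ kSel P` the
leaf handed).  WHICH CHILD BLOCKS `stub_nodes13` on this line = the remaining hypothesis list: `Provisos₁₃` at the re-pin, `hZ`, signs, world binding, N05–N11 rows, N13 (UV₁₃), N12's displays.
COMPOSITE: nothing discharged as a node. [cite: Balaban1989LargeFieldII, Thm 1 p.355, (0.1) pp.355–356; Balaban1989LargeFieldI, (0.2)–(0.6) p.176, Prop. 1 (1.78) p.194, (1.80) p.195, (1.89) p.198, (1.99)–(1.102) pp.200–201; Balaban1988Convergent, Thm 2 p.263, (3.22)–(3.25) pp.269–270 (bookkeeping)] -/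
theorem nodesAtSomeRecord₁₃_of_fourPin_liveRepin₁₃_of_massLive (hP : (Θ.liveRepin₁₃ F N).Provisos₁₃ F N) (hθ : Θ.Admissible F N) (hZ : Θ.ZtUnity F N)
    (hκ : 0 ≤ Θ.s2.lf.κ) (hE₀ : 0 ≤ Θ.s2.lf.E₀) (hB₀ : 0 ≤ Θ.s2.lf.B₀)
    (Mstar : ℕ) (ops : OpsY N (Θ.liveRepin₁₃ F N).toStage3Params Mstar) (ζ : ResidZ F N) (w : WorldP)
    (hC : w.C = (datumOfRecord₁₃ F N (Θ.liveRepin₁₃ F N) hP).C) (hγ : 0 < w.γ ∧ w.γ ≤ (Θ.liveRepin₁₃ F N).γ) (hL : w.L = ((Θ.liveRepin₁₃ F N).L : ℝ))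
    (hup : ∀ P, w.up P = upOfRecord₅C F N ((Θ.liveRepin₁₃ F N).view₁₃B10YZW F N Mstar ops ζ lamW) P)
    (h05 : ∀ P : B12.RunParams,
      B8LeafR ((Θ.liveRepin₁₃ F N).res.X P).d8 ((Θ.liveRepin₁₃ F N).res.X P).L8 ((Θ.liveRepin₁₃ F N).res.X P).C₂ ((Θ.liveRepin₁₃ F N).res.X P).B₁'
        ((Θ.liveRepin₁₃ F N).res.X P).B₀' ((Θ.liveRepin₁₃ F N).res.X P).B₁ ((Θ.liveRepin₁₃ F N).res.X P).B₂ ((Θ.liveRepin₁₃ F N).res.X P).c₁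
        ((Θ.liveRepin₁₃ F N).res.X P).inp8 ((Θ.liveRepin₁₃ F N).res.X P).B₀β ((Θ.liveRepin₁₃ F N).res.X P).loc8 ((Θ.liveRepin₁₃ F N).res.X P).fam8R
        ((Θ.liveRepin₁₃ F N).res.X P).lan8 ((Θ.liveRepin₁₃ F N).res.X P).cub8 ((Θ.liveRepin₁₃ F N).res.X P).toAxial8)
    (h06 : B9LeafX (Y9OfRecord N (Θ.liveRepin₁₃ F N).toStage3Params Mstar ops))
    (h07 : B11Leaf (Z11OfRecord F N ζ))
    (h08 : PrintedUV3V N (Θ.liveRepin₁₃ F N).L)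
    (h09 : ∀ P : B12.RunParams, B12Sec2to5.Lemma4Printed ((Θ.liveRepin₁₃ F N).res.X P).F12 ((Θ.liveRepin₁₃ F N).res.X P).c12)
    (h09T : ∀ P : B12.RunParams, (leavesP w P).smallCouplings → (leavesP w P).smallFieldInductive)
    (h10 : ∀ P : B12.RunParams, B9LeafX (Y9OfRecord N (Θ.liveRepin₁₃ F N).toStage3Params Mstar ops) →
      (B10.Thm1PrintedCompact (((Θ.liveRepin₁₃ F N).view₁₃B10YZW F N Mstar ops ζ lamW).res.X P).runs10 ∧
          B10.Thm2Printed (((Θ.liveRepin₁₃ F N).view₁₃B10YZW F N Mstar ops ζ lamW).res.X P).runs10) →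
        B11Leaf (Z11OfRecord F N ζ) → B12Sec2to5.Lemma4Printed ((Θ.liveRepin₁₃ F N).res.X P).F12 ((Θ.liveRepin₁₃ F N).res.X P).c12 →
          B13.Lemma1Printed ((Θ.liveRepin₁₃ F N).res.X P).S13 ((Θ.liveRepin₁₃ F N).res.X P).c13 ∧
            B13.Lemma2Printed ((Θ.liveRepin₁₃ F N).res.X P).S13 ((Θ.liveRepin₁₃ F N).res.X P).c13 ∧
            B13.Lemma3Printed ((Θ.liveRepin₁₃ F N).res.X P).S13 ((Θ.liveRepin₁₃ F N).res.X P).c13)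
    (h11 : ∀ P : B12.RunParams, (leavesP w P).b7 → (leavesP w P).b8 → (leavesP w P).b9 → (leavesP w P).b10 → (leavesP w P).b11 →
      (leavesP w P).smallCouplings → (leavesP w P).smallFieldInductive → (leavesP w P).flowControl →
        ∀ k, k < P.K → SLaw₁₃ F N (Θ.liveRepin₁₃ F N) P k → TLaw₁₃ F N (Θ.liveRepin₁₃ F N) P k)
    -- N12's displays, run by run
    (h12deg : ∀ P : B12.RunParams, P.K ≤ lamW.kSel P → B15Leaf (WOfRecord₁₃ F N (Θ.liveRepin₁₃ F N) lamW P))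
    (h12pin : ∀ P : B12.RunParams, lamW.kSel P < P.K → lamW.D1100 P
      = rPrimeDataOfSel (reprTOfRecord₁₃ F N (Θ.liveRepin₁₃ F N) P (lamW.kSel P))
          ((Θ.liveRepin₁₃ F N).ppSel P (gOfRecord₁₃ F N (Θ.liveRepin₁₃ F N) P) (lamW.kSel P + 1))
          (fibOfSeq F (Θ.liveRepin₁₃ F N).ν (Θ.liveRepin₁₃ F N).τ9 P (gOfRecord₁₃ F N (Θ.liveRepin₁₃ F N) P) (lamW.kSel P + 1)))
    (h12mass : ∀ P : B12.RunParams, lamW.kSel P < P.K → ∀ s, LiveSeq F N Θ.ν Θ.τ9 P (gOfRecord₁₃ F N (Θ.liveRepin₁₃ F N) P) (lamW.kSel P + 1)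
        (slotsTOfRecord F N Θ.ν Θ.τ9 (EOfRecord₁₃ F N (Θ.liveRepin₁₃ F N)) (wOfRecord₉ F N (Θ.liveRepin₁₃ F N).toStage9Params)
          (Θ.liveRepin₁₃ F N).ppSel P (gOfRecord₁₃ F N (Θ.liveRepin₁₃ F N) P) (lamW.kSel P + 1)) s →
      0 < ∫ V, rterm (reprTOfRecord₁₃ F N (Θ.liveRepin₁₃ F N) P (lamW.kSel P)) s V ∂(fieldMeasure (F.P P.K) (lamW.kSel P + 1) (SU N)))
    (h12P1 : ∀ P : B12.RunParams, lamW.kSel P < P.K → Prop1Printed (lamW.LF P))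
    (h12i180 : ∀ P : B12.RunParams, lamW.kSel P < P.K → ∀ U, new189 (lamW.D189 P) U → ∀ i, (lamW.D189 P).h ≤ i → i ≤ (lamW.D189 P).k →
      ∀ q ∈ plaqsOf (dom (lamW.D189 P) i),
        Ineq180 ((lamW.D189 P).dev0 U q) ((lamW.D189 P).ε (lamW.D189 P).k) (lamW.D189 P).η (lamW.D189 P).B₃ (lamW.D189 P).B₅ (lamW.D189 P).M (lamW.D189 P).δ
          ((lamW.D189 P).dist q) (lamW.D189 P).O1)
    (h12c189 : ∀ P : B12.RunParams, lamW.kSel P < P.K → Claim189 (new189 (lamW.D189 P)) (chiPP (lamW.D189 P)))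
    (hUV : ∀ P : B12.RunParams, (genFlow (betaOfRecord₁₃ F N (Θ.liveRepin₁₃ F N)) P.g0).InInterval w.γ P.K → ∀ k, k ≤ P.K →
      SLaw₁₃ F N (Θ.liveRepin₁₃ F N) P k → ∀ U : GaugeField (F.P P.K) k (SU N),
        chiβOfRecord₁₃ F N (Θ.liveRepin₁₃ F N) P.K (gOfRecord₁₃ F N (Θ.liveRepin₁₃ F N) P) k U *
              Real.exp (-(1 / (gOfRecord₁₃ F N (Θ.liveRepin₁₃ F N) P k) ^ 2 * wilsonBGOfRecord F N (Θ.liveRepin₁₃ F N).εbg P k U)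
                - w.em (gOfRecord₁₃ F N (Θ.liveRepin₁₃ F N) P k) * (Fintype.card (Site (F.P P.K) k) : ℝ)) ≤
            densOfRecord₁₃ F N (Θ.liveRepin₁₃ F N) P k U ∧
        densOfRecord₁₃ F N (Θ.liveRepin₁₃ F N) P k U ≤ Real.exp (w.ep (gOfRecord₁₃ F N (Θ.liveRepin₁₃ F N) P k) * (Fintype.card (Site (F.P P.K) k) : ℝ))) :
    ∃ (θ' : Stage13Params F N) (h' : θ'.Provisos₁₃ F N) (w' : WorldP), (θ'.ZtUnity F N ∧ θ'.SlotsNondegenerate₁₃ F N) ∧ θ'.Admissible F N ∧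
      IsRecordOfRecord₁₃C F N (datumOfRecord₁₃ F N θ' h') w' ∧ ∀ P : B12.RunParams, Nodes (leavesP w' P) :=
  N24_nodesAtSomeRecord₁₃_of_fourPin_pointed (Θ.liveRepin₁₃ F N) hP hθ.liveRepin₁₃
    ⟨Stage13Params.ZtUnity.liveRepin₁₃ hZ, Stage13Params.slotsNondegenerate₁₃_liveRepin F N Θ hP⟩ Mstar ops ζ lamW w hC hγ hL hup h05 h06 h07 h08 h09 h09T h10 h11
    (b15Leaf_WOfRecord₁₃_liveRepin₁₃_all_of_massLive Θ lamW hP h12deg h12pin h12mass h12P1 h12i180 h12c189)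
    (fun P k hk => laws₁₃_of_liveSel F N (Θ.liveRepin₁₃ F N) P hP hθ.liveRepin₁₃ hκ hE₀ hB₀ (Stage13Params.liveRepin₁₃_ppSel F N Θ) k hk) hUV

/-- **★ THE CONSEQUENT OF ITEM K1‴ `StabilityBAtRecordR13e` IN ITS θ-KEYED SHAPE, WITNESSED BY `(Θ.liveRepin₁₃, hP)` OVER THE FOUR-PIN VIEW, N12's ROW REPLACED BY ITS PER-RUN DISPLAYS**
(n24-c module 40's `N24_stabilityBR13e_thetaShape16_fourPin_pointed` at the live re-pin: guard, admissibility, N13's (R₁₃) row DISCHARGED BY NAME; N12 by §3; β-box pair and every other row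
displayed).  COMPOSITE: nothing is discharged. [cite: Balaban1989LargeFieldII, Thm 1 p.355, (0.1) pp.355–356, p.391; Balaban1989LargeFieldI, (0.2)–(0.6) p.176, Prop. 1 (1.78) p.194, (1.80) p.195, (1.89) p.198, (1.99)–(1.102) pp.200–201; Balaban1987RG1, Thm 3 p.264, (1.22) p.264; Balaban1988Convergent, (3.22)–(3.25) pp.269–270 (bookkeeping + elementary window)] -/
theorem stabilityBR13e_thetaShape16_fourPin_liveRepin₁₃_of_massLive (hP : (Θ.liveRepin₁₃ F N).Provisos₁₃ F N) (hθ : Θ.Admissible F N)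
    (hZ : Θ.ZtUnity F N) (hκ : 0 ≤ Θ.s2.lf.κ) (hE₀ : 0 ≤ Θ.s2.lf.E₀) (hB₀ : 0 ≤ Θ.s2.lf.B₀)
    (Mstar : ℕ) (ops : OpsY N (Θ.liveRepin₁₃ F N).toStage3Params Mstar) (ζ : ResidZ F N) (w : WorldP)
    (hC : w.C = (datumOfRecord₁₃ F N (Θ.liveRepin₁₃ F N) hP).C) (hγ : 0 < w.γ ∧ w.γ ≤ (Θ.liveRepin₁₃ F N).γ) (hL : w.L = ((Θ.liveRepin₁₃ F N).L : ℝ))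
    (hup : ∀ P, w.up P = upOfRecord₅C F N ((Θ.liveRepin₁₃ F N).view₁₃B10YZW F N Mstar ops ζ lamW) P)
    (h05 : ∀ P : B12.RunParams,
      B8LeafR ((Θ.liveRepin₁₃ F N).res.X P).d8 ((Θ.liveRepin₁₃ F N).res.X P).L8 ((Θ.liveRepin₁₃ F N).res.X P).C₂ ((Θ.liveRepin₁₃ F N).res.X P).B₁'
        ((Θ.liveRepin₁₃ F N).res.X P).B₀' ((Θ.liveRepin₁₃ F N).res.X P).B₁ ((Θ.liveRepin₁₃ F N).res.X P).B₂ ((Θ.liveRepin₁₃ F N).res.X P).c₁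
        ((Θ.liveRepin₁₃ F N).res.X P).inp8 ((Θ.liveRepin₁₃ F N).res.X P).B₀β ((Θ.liveRepin₁₃ F N).res.X P).loc8 ((Θ.liveRepin₁₃ F N).res.X P).fam8R
        ((Θ.liveRepin₁₃ F N).res.X P).lan8 ((Θ.liveRepin₁₃ F N).res.X P).cub8 ((Θ.liveRepin₁₃ F N).res.X P).toAxial8)
    (h06 : B9LeafX (Y9OfRecord N (Θ.liveRepin₁₃ F N).toStage3Params Mstar ops))
    (h07 : B11Leaf (Z11OfRecord F N ζ))
    (h08 : PrintedUV3V N (Θ.liveRepin₁₃ F N).L)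
    (h09 : ∀ P : B12.RunParams, B12Sec2to5.Lemma4Printed ((Θ.liveRepin₁₃ F N).res.X P).F12 ((Θ.liveRepin₁₃ F N).res.X P).c12)
    (h09T : ∀ P : B12.RunParams, (leavesP w P).smallCouplings → (leavesP w P).smallFieldInductive)
    (h10 : ∀ P : B12.RunParams, B9LeafX (Y9OfRecord N (Θ.liveRepin₁₃ F N).toStage3Params Mstar ops) →
      (B10.Thm1PrintedCompact (((Θ.liveRepin₁₃ F N).view₁₃B10YZW F N Mstar ops ζ lamW).res.X P).runs10 ∧
          B10.Thm2Printed (((Θ.liveRepin₁₃ F N).view₁₃B10YZW F N Mstar ops ζ lamW).res.X P).runs10) →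
        B11Leaf (Z11OfRecord F N ζ) → B12Sec2to5.Lemma4Printed ((Θ.liveRepin₁₃ F N).res.X P).F12 ((Θ.liveRepin₁₃ F N).res.X P).c12 →
          B13.Lemma1Printed ((Θ.liveRepin₁₃ F N).res.X P).S13 ((Θ.liveRepin₁₃ F N).res.X P).c13 ∧
            B13.Lemma2Printed ((Θ.liveRepin₁₃ F N).res.X P).S13 ((Θ.liveRepin₁₃ F N).res.X P).c13 ∧
            B13.Lemma3Printed ((Θ.liveRepin₁₃ F N).res.X P).S13 ((Θ.liveRepin₁₃ F N).res.X P).c13)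
    (h11 : ∀ P : B12.RunParams, (leavesP w P).b7 → (leavesP w P).b8 → (leavesP w P).b9 → (leavesP w P).b10 → (leavesP w P).b11 →
      (leavesP w P).smallCouplings → (leavesP w P).smallFieldInductive → (leavesP w P).flowControl →
        ∀ k, k < P.K → SLaw₁₃ F N (Θ.liveRepin₁₃ F N) P k → TLaw₁₃ F N (Θ.liveRepin₁₃ F N) P k)
    (h12deg : ∀ P : B12.RunParams, P.K ≤ lamW.kSel P → B15Leaf (WOfRecord₁₃ F N (Θ.liveRepin₁₃ F N) lamW P))
    (h12pin : ∀ P : B12.RunParams, lamW.kSel P < P.K → lamW.D1100 P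
      = rPrimeDataOfSel (reprTOfRecord₁₃ F N (Θ.liveRepin₁₃ F N) P (lamW.kSel P))
          ((Θ.liveRepin₁₃ F N).ppSel P (gOfRecord₁₃ F N (Θ.liveRepin₁₃ F N) P) (lamW.kSel P + 1))
          (fibOfSeq F (Θ.liveRepin₁₃ F N).ν (Θ.liveRepin₁₃ F N).τ9 P (gOfRecord₁₃ F N (Θ.liveRepin₁₃ F N) P) (lamW.kSel P + 1)))
    (h12mass : ∀ P : B12.RunParams, lamW.kSel P < P.K → ∀ s, LiveSeq F N Θ.ν Θ.τ9 P (gOfRecord₁₃ F N (Θ.liveRepin₁₃ F N) P) (lamW.kSel P + 1)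
        (slotsTOfRecord F N Θ.ν Θ.τ9 (EOfRecord₁₃ F N (Θ.liveRepin₁₃ F N)) (wOfRecord₉ F N (Θ.liveRepin₁₃ F N).toStage9Params)
          (Θ.liveRepin₁₃ F N).ppSel P (gOfRecord₁₃ F N (Θ.liveRepin₁₃ F N) P) (lamW.kSel P + 1)) s →
      0 < ∫ V, rterm (reprTOfRecord₁₃ F N (Θ.liveRepin₁₃ F N) P (lamW.kSel P)) s V ∂(fieldMeasure (F.P P.K) (lamW.kSel P + 1) (SU N)))
    (h12P1 : ∀ P : B12.RunParams, lamW.kSel P < P.K → Prop1Printed (lamW.LF P))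
    (h12i180 : ∀ P : B12.RunParams, lamW.kSel P < P.K → ∀ U, new189 (lamW.D189 P) U → ∀ i, (lamW.D189 P).h ≤ i → i ≤ (lamW.D189 P).k →
      ∀ q ∈ plaqsOf (dom (lamW.D189 P) i),
        Ineq180 ((lamW.D189 P).dev0 U q) ((lamW.D189 P).ε (lamW.D189 P).k) (lamW.D189 P).η (lamW.D189 P).B₃ (lamW.D189 P).B₅ (lamW.D189 P).M (lamW.D189 P).δ
          ((lamW.D189 P).dist q) (lamW.D189 P).O1)
    (h12c189 : ∀ P : B12.RunParams, lamW.kSel P < P.K → Claim189 (new189 (lamW.D189 P)) (chiPP (lamW.D189 P)))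
    (hUV : ∀ P : B12.RunParams, (genFlow (betaOfRecord₁₃ F N (Θ.liveRepin₁₃ F N)) P.g0).InInterval w.γ P.K → ∀ k, k ≤ P.K →
      SLaw₁₃ F N (Θ.liveRepin₁₃ F N) P k → ∀ U : GaugeField (F.P P.K) k (SU N),
        chiβOfRecord₁₃ F N (Θ.liveRepin₁₃ F N) P.K (gOfRecord₁₃ F N (Θ.liveRepin₁₃ F N) P) k U *
              Real.exp (-(1 / (gOfRecord₁₃ F N (Θ.liveRepin₁₃ F N) P k) ^ 2 * wilsonBGOfRecord F N (Θ.liveRepin₁₃ F N).εbg P k U)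
                - w.em (gOfRecord₁₃ F N (Θ.liveRepin₁₃ F N) P k) * (Fintype.card (Site (F.P P.K) k) : ℝ)) ≤
            densOfRecord₁₃ F N (Θ.liveRepin₁₃ F N) P k U ∧
        densOfRecord₁₃ F N (Θ.liveRepin₁₃ F N) P k U ≤ Real.exp (w.ep (gOfRecord₁₃ F N (Θ.liveRepin₁₃ F N) P k) * (Fintype.card (Site (F.P P.K) k) : ℝ)))
    (hlo : BetaLowerH w.b w.γ (datumOfRecord₁₃ F N (Θ.liveRepin₁₃ F N) hP).βfun)
    (hhi : BetaUpperH w.βup w.γ (datumOfRecord₁₃ F N (Θ.liveRepin₁₃ F N) hP).βfun) :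
    ∃ (θ' : Stage13Params F N) (h' : θ'.Provisos₁₃ F N), (θ'.ZtUnity F N ∧ θ'.SlotsNondegenerate₁₃ F N) ∧ θ'.Admissible F N ∧
      B16.EndStatementBPrinted (datumOfRecord₁₃ F N θ' h').C ∧
      ∃ γ₁ : ℝ, 0 < γ₁ ∧ ∀ γ : ℝ, 0 < γ → γ ≤ γ₁ → ∃ P : B12.RunParams, 1 ≤ P.K ∧ ((datumOfRecord₁₃ F N θ' h').C P).flow.InInterval γ P.K :=
  N24_stabilityBR13e_thetaShape16_fourPin_pointed (Θ.liveRepin₁₃ F N) hP hθ.liveRepin₁₃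
    ⟨Stage13Params.ZtUnity.liveRepin₁₃ hZ, Stage13Params.slotsNondegenerate₁₃_liveRepin F N Θ hP⟩ Mstar ops ζ lamW w hC hγ hL hup h05 h06 h07 h08 h09 h09T h10 h11
    (b15Leaf_WOfRecord₁₃_liveRepin₁₃_all_of_massLive Θ lamW hP h12deg h12pin h12mass h12P1 h12i180 h12c189)
    (fun P k hk => laws₁₃_of_liveSel F N (Θ.liveRepin₁₃ F N) P hP hθ.liveRepin₁₃ hκ hE₀ hB₀ (Stage13Params.liveRepin₁₃_ppSel F N Θ) k hk) hUV hlo hhi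

end Sockets

end Summit.QuantumFields.YangMills.BalabanUVNodes.N12AtRecord13LiveLine
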